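import Summits.FinalStateConjecture.FinalStateConjecture.Theorems.PhaseMixingCaptureCaptureSufficesTameNoC0TubeDrift
import Summits.FinalStateConjecture.FinalStateConjecture.Theorems.PhaseMixingCaptureCaptureSufficesTameNoC0TubeTransplant
import Literature.Geometry.Lorentzian.OpensCausality
import Literature.Geometry.Lorentzian.LorentzianDistance
import HarnessLib

/-!
# `CaptureSufficesTame` (stmt-FinalStateConjecture-17270), line `only-the-third-law-is-generic`, NoC0KerrChart programme:
# stub `stub_noC0_tubeAnalysis` — the tube analysis, assembled

The six explicit Kerr-side facts consumed by the limit argument of the model point NoC0KerrChart (no C⁰-honest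
late chart of a Kerr exterior into Minkowski space), lead c10:

* (DL), (DL2), (DL3) the forward drift `∂_{t*}` (`NoC0.kerr_bilin_basisVector_zero_le_of_le`,
  `NoC0.kerr_bilin_le_of_opNorm_le`, `NoC0.kerr_bilin_add_smul_basisVector_zero_le`; file `…NoC0TubeDrift`);
* (TL) transplanting timelike-with-margin curves to perturbed cone fields (`NoC0.kerr_transplant`; file
  `…NoC0TubeTransplant`);
* (ARC) future timelike curve segments of the Kerr exterior have positive length
  (`NoC0.arcLength_pos_of_isFutureTimelikeCurveOn`, this file: measurability of the coordinate velocity and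
  positivity of the speed, as in `NoC0.lorentzDist_pos_of_mem_chronologicalFuture`);
* (INC) the drifted `t*`-parametrised photon orbit (`NoC0.kerr_drifted_orbitCurve`; file `…NoC0TubeDrift`);
* `stub_noC0_tubeAnalysis` — the registered text of the stub, by name.

References: M. Visser, arXiv:0706.0622, (32)–(35) (key `arXiv07060622`); J. Sbierski, Anal. PDE 8 (2015), §7A
(key `Sbierski2015`); B. O'Neill, *Semi-Riemannian geometry*, 1983, Ch. 5, Def. 5.11 (key `ONeill1983`).
-/

set_option linter.dupNamespace false
set_option maxSynthPendingDepth 3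

noncomputable section

open Set Filter Function Bundle Metric MeasureTheory
open scoped Manifold ContDiff Topology ENNReal

namespace Summit.FinalStateConjecture.FinalStateConjecture.Theorems.PhaseMixingCaptureCaptureSufficesTame

open Literature.Geometry.Lorentzian

namespace NoC0

/-! ## (ARC) Timelike curve segments of the Kerr exterior have positive length -/

variable {M a : ℝ}

/-- **A future timelike curve segment of the Kerr exterior has positive length**: for
`γ : [t₁, t₂] → Kerr exterior` future timelike, `t₁ < t₂`, `0 < L(γ|[t₁, t₂]) = ∫ |g(γ', γ')|^{1/2}`
(measurability of the coordinate velocity `deriv` of the continuously extended coordinate curve, continuity of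
the Kerr–Schild components on the exterior, positivity of the speed on `(t₁, t₂)`). O'Neill 1983, Ch. 5,
Def. 5.11. [cite: ONeill1983, Ch. 5, Def. 5.11] -/
theorem arcLength_pos_of_isFutureTimelikeCurveOn [Kerr.Facts] (hM : 0 ≤ M) (γ : ℝ → Kerr.exterior M a)
    (t₁ t₂ : ℝ) (ht : t₁ < t₂)
    (hγ : (Kerr.smoothMetric M a (Kerr.rPlus M a)).IsFutureTimelikeCurveOn
      (Kerr.exteriorSpacetime M a hM).timeOrientation γ (Icc t₁ t₂)) :
    0 < (Kerr.smoothMetric M a (Kerr.rPlus M a)).toPseudoRiemannianMetric.arcLength γ t₁ t₂ := by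
  -- the coordinate curve, continuously extended outside `[t₁, t₂]`
  set c : ℝ → E4 := fun t ↦ (γ t : E4) with hc
  set ce : ℝ → E4 := fun t ↦ c (projIcc t₁ t₂ ht.le t) with hce
  have hcd : ∀ t ∈ Icc t₁ t₂, DifferentiableAt ℝ c t := fun t ht' ↦
    mdifferentiableAt_iff_differentiableAt.mp
      ((mdifferentiableAt_subtypeVal_comp_curve_iff (I := 𝓘(ℝ, E4)) (Kerr.exterior M a)).2 (hγ t ht').1)
  have hcc : ContinuousOn c (Icc t₁ t₂) := fun t ht' ↦ (hcd t ht').continuousAt.continuousWithinAt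
  have hce_cont : Continuous ce := by
    have : ce = (Icc t₁ t₂).restrict c ∘ projIcc t₁ t₂ ht.le := by
      funext t; rfl
    rw [this]
    exact (continuousOn_iff_continuous_restrict.1 hcc).comp continuous_projIcc
  -- on the open interval, `ce` agrees with `c` near every point
  have hagree : ∀ t ∈ Ioo t₁ t₂, ce =ᶠ[𝓝 t] c := by
    intro t ht'
    filter_upwards [Ioo_mem_nhds ht'.1 ht'.2] with s hs
    simp only [hce, projIcc_of_mem ht.le (Ioo_subset_Icc_self hs)]
  have hderiv : ∀ t ∈ Ioo t₁ t₂, deriv ce t = deriv c t := fun t ht' ↦ (hagree t ht').deriv_eq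
  -- the measurable integrand
  set F : ℝ → ℝ := fun t ↦ Real.sqrt |Kerr.bilin M a (ce t) (deriv ce t) (deriv ce t)| with hF
  have hFm : Measurable F := by
    have h1 : Measurable (deriv ce) := measurable_deriv ce
    have hce_mem : ∀ t, ce t ∈ (Kerr.region a (Kerr.rPlus M a) : Set E4) := fun t ↦ (γ _).2
    have hb : Continuous fun t ↦ Kerr.bilin M a (ce t) :=
      ((Kerr.contDiffOn_bilin_region M a (Kerr.rPlus M a) (n := 0)).continuousOn).comp_continuous
        hce_cont hce_mem
    have h2 : Continuous fun p : (E4 →L[ℝ] E4 →L[ℝ] ℝ) × E4 ↦ p.1 p.2 p.2 := by fun_prop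
    have h3 : Measurable fun t ↦ Kerr.bilin M a (ce t) (deriv ce t) (deriv ce t) :=
      h2.measurable.comp (hb.measurable.prodMk h1)
    exact Real.continuous_sqrt.measurable.comp (continuous_abs.measurable.comp h3)
  -- the speed is `F` on the open interval
  have hspeed : ∀ t ∈ Ioo t₁ t₂,
      (Kerr.smoothMetric M a (Kerr.rPlus M a)).toPseudoRiemannianMetric.speed γ t = F t := by
    intro t ht'
    have hvel : (velocity 𝓘(ℝ, E4) γ t : E4) = deriv c t := by
      rw [← velocity_subtypeVal_comp (I := 𝓘(ℝ, E4)) (Kerr.exterior M a) γ t]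
      change mfderiv 𝓘(ℝ, ℝ) 𝓘(ℝ, E4) (Subtype.val ∘ γ) t (1 : ℝ) = _
      rw [mfderiv_eq_fderiv]
      rfl
    rw [PseudoRiemannianMetric.speed_def, hF]
    simp only
    rw [hderiv t ht']
    have hcet : ce t = c t := (hagree t ht').eq_of_nhds
    rw [hcet]
    show Real.sqrt |Kerr.bilin M a (c t) (velocity 𝓘(ℝ, E4) γ t) (velocity 𝓘(ℝ, E4) γ t)| = _
    rw [hvel]
  have hFpos : ∀ t ∈ Ioo t₁ t₂, 0 < F t := by
    intro t ht'
    rw [← hspeed t ht', PseudoRiemannianMetric.speed_def]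
    obtain ⟨-, htl, -⟩ := hγ t (Ioo_subset_Icc_self ht')
    have : (Kerr.smoothMetric M a (Kerr.rPlus M a)).val (γ t) (velocity 𝓘(ℝ, E4) γ t)
        (velocity 𝓘(ℝ, E4) γ t) < 0 := htl
    exact Real.sqrt_pos.2 (abs_pos.2 this.ne)
  -- compute the length over the open interval
  rw [PseudoRiemannianMetric.arcLength_eq_lintegral_Ioo]
  have hcongr : ∫⁻ t in Ioo t₁ t₂, ENNReal.ofReal
      ((Kerr.smoothMetric M a (Kerr.rPlus M a)).toPseudoRiemannianMetric.speed γ t) =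
      ∫⁻ t in Ioo t₁ t₂, ENNReal.ofReal (F t) :=
    MeasureTheory.setLIntegral_congr_fun measurableSet_Ioo fun t ht' ↦ by rw [hspeed t ht']
  rw [hcongr]
  have hm : Measurable fun t ↦ ENNReal.ofReal (F t) := ENNReal.measurable_ofReal.comp hFm
  rw [MeasureTheory.lintegral_pos_iff_support hm]
  have hsub : Ioo t₁ t₂ ⊆ Function.support fun t ↦ ENNReal.ofReal (F t) := fun t ht' ↦ by
    rw [Function.mem_support]
    exact (ENNReal.ofReal_pos.2 (hFpos t ht')).ne'
  calc (0 : ℝ≥0∞) < volume (Ioo t₁ t₂) := by rw [Real.volume_Ioo]; exact ENNReal.ofReal_pos.2 (by linarith)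
    _ = (volume.restrict (Ioo t₁ t₂)) (Ioo t₁ t₂) := by
        rw [MeasureTheory.Measure.restrict_apply_self]
    _ ≤ (volume.restrict (Ioo t₁ t₂)) (Function.support fun t ↦ ENNReal.ofReal (F t)) :=
        MeasureTheory.measure_mono hsub

end NoC0

/-! ## The stub, assembled -/

/-- **Stub `stub_noC0_tubeAnalysis` — THE TUBE ANALYSIS of the NoC0KerrChart limit argument (explicit Kerr–Schild
facts).** (DL) wherever `H ≤ 2/5`, a future nearly-causal `v` has `g(v, ∂_{t*}) ≤ −v⁰/20`; (DL2) `B`-causal vectors for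
an `ε`-perturbed cone `B` (`ε ≤ 1/4`) have `g(v, v) ≤ 4ε(v⁰)²`; (DL3) the forward drift `v + κ∂_{t*}` of a `B`-causal
`v` with `v⁰ = 1` (`ε ≤ 1/80`) has `g ≤ 4ε − κ/10`; (TL) `g`-timelike-with-margin curves over a compact set, sheared
at the endpoints by less than `δ`, are `B`-timelike future for every cone field `B` `δ`-close to `g`; (ARC) future
timelike curve segments of the Kerr exterior have positive length; (INC) the drifted `t*`-parametrised retrograde
photon orbit has velocity `V` with `g(V, V) ≤ −κ/10`, `V⁰ = 1 + κ`, `‖V‖ ≤ 3 + κ`. Visser arXiv:0706.0622 (32)–(35);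
Sbierski 2015 §7A; O'Neill 1983 Ch. 5 Def. 5.11.
[cite: arXiv07060622, (32)–(35)] [cite: Sbierski2015, §7A] [cite: ONeill1983, Ch. 5, Def. 5.11] -/
theorem stub_noC0_tubeAnalysis :
    (∀ (M a : ℝ) (x v : E4), 0 ≤ M → Kerr.scalarH M a x ≤ 2 / 5 → 0 < v 0 →
      Kerr.bilin M a x v v ≤ (1 / 20) * (v 0) ^ 2 →
      Kerr.bilin M a x v (E4.basisVector 0) ≤ -(1 / 20) * v 0) ∧
    (∀ (M a : ℝ) (x v : E4) (B : E4 →L[ℝ] E4 →L[ℝ] ℝ) (ε : ℝ), 0 ≤ M → ‖B - Kerr.bilin M a x‖ ≤ ε →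
      ε ≤ 1 / 4 → B v v ≤ 0 → Kerr.bilin M a x v v ≤ 4 * ε * (v 0) ^ 2) ∧
    (∀ (M a : ℝ) (x v : E4) (B : E4 →L[ℝ] E4 →L[ℝ] ℝ) (ε κ : ℝ), 0 ≤ M → Kerr.scalarH M a x ≤ 2 / 5 →
      ‖B - Kerr.bilin M a x‖ ≤ ε → ε ≤ 1 / 80 → B v v ≤ 0 → v 0 = 1 → 0 ≤ κ →
      Kerr.bilin M a x (v + κ • E4.basisVector 0) (v + κ • E4.basisVector 0) ≤ 4 * ε - κ / 10) ∧
    (∀ (M a : ℝ) (K₁ : Set E4) (δ₀ : ℝ), 0 ≤ M → IsCompact K₁ → 0 < δ₀ →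
      cthickening δ₀ K₁ ⊆ (Kerr.exterior M a : Set E4) →
      ∀ (c c' : ℝ → E4) (L : ℝ), 0 < L → (∀ r ∈ Icc 0 L, HasDerivAt c (c' r) r) → ContinuousOn c' (Icc 0 L) →
      (∀ r ∈ Icc 0 L, c r ∈ K₁ ∧ Kerr.bilin M a (c r) (c' r) (c' r) < 0 ∧ 0 < c' r 0) →
      ∃ δ > 0, δ ≤ δ₀ ∧ ∀ (z₁ z₂ : E4), ‖z₁‖ < δ → ‖z₂‖ < δ → ∀ B : E4 → E4 →L[ℝ] E4 →L[ℝ] ℝ,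
        (∀ y ∈ cthickening δ₀ K₁, ‖B y - Kerr.bilin M a y‖ < δ) →
        ∀ r ∈ Icc 0 L, c r + (1 - r / L) • z₁ + (r / L) • z₂ ∈ thickening δ₀ K₁ ∧
          HasDerivAt (fun r ↦ c r + (1 - r / L) • z₁ + (r / L) • z₂) (c' r + (1 / L) • (z₂ - z₁)) r ∧
          B (c r + (1 - r / L) • z₁ + (r / L) • z₂) (c' r + (1 / L) • (z₂ - z₁)) (c' r + (1 / L) • (z₂ - z₁)) < 0 ∧
          0 < (c' r + (1 / L) • (z₂ - z₁)) 0) ∧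
    (∀ (M a : ℝ) [Kerr.Facts] (hM : 0 ≤ M) (γ : ℝ → Kerr.exterior M a) (t₁ t₂ : ℝ), t₁ < t₂ →
      (Kerr.smoothMetric M a (Kerr.rPlus M a)).IsFutureTimelikeCurveOn
        (Kerr.exteriorSpacetime M a hM).timeOrientation γ (Icc t₁ t₂) →
      0 < (Kerr.smoothMetric M a (Kerr.rPlus M a)).toPseudoRiemannianMetric.arcLength γ t₁ t₂) ∧
    (∀ (M a r₀ q e κ w : ℝ), 0 < M → 0 ≤ a → a ≤ M → 3 * M ≤ r₀ → r₀ * (r₀ - 3 * M) ^ 2 = 4 * a ^ 2 * M →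
      q = √(M / r₀ ^ 3) → e = 1 - a * q → 0 < κ →
      0 < e ∧ e ≤ 1 ∧ 0 < q ∧
      HasDerivAt (fun w ↦ Kerr.orbitCurve a r₀ q (w / e) + (κ * w) • E4.basisVector 0)
        ((1 / e) • Kerr.orbitVel a q (Kerr.orbitCurve a r₀ q (w / e)) + κ • E4.basisVector 0) w ∧
      Kerr.bilin M a (Kerr.orbitCurve a r₀ q (w / e) + (κ * w) • E4.basisVector 0)
        ((1 / e) • Kerr.orbitVel a q (Kerr.orbitCurve a r₀ q (w / e)) + κ • E4.basisVector 0)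
        ((1 / e) • Kerr.orbitVel a q (Kerr.orbitCurve a r₀ q (w / e)) + κ • E4.basisVector 0) ≤ -(κ / 10) ∧
      ((1 / e) • Kerr.orbitVel a q (Kerr.orbitCurve a r₀ q (w / e)) + κ • E4.basisVector 0) 0 = 1 + κ ∧
      ‖(1 / e) • Kerr.orbitVel a q (Kerr.orbitCurve a r₀ q (w / e)) + κ • E4.basisVector 0‖ ≤ 3 + κ) := by
  refine ⟨NoC0.kerr_bilin_basisVector_zero_le_of_le, NoC0.kerr_bilin_le_of_opNorm_le,
    NoC0.kerr_bilin_add_smul_basisVector_zero_le, NoC0.kerr_transplant, ?_, NoC0.kerr_drifted_orbitCurve⟩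
  intro M a _ hM γ t₁ t₂ ht hγ
  exact NoC0.arcLength_pos_of_isFutureTimelikeCurveOn hM γ t₁ t₂ ht hγ

end Summit.FinalStateConjecture.FinalStateConjecture.Theorems.PhaseMixingCaptureCaptureSufficesTame

end
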